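import Literature.Analysis.FunctionSpaces.MoserIteration
import Literature.Analysis.FunctionSpaces.BMOJohnNirenberg
import HarnessLib

/-!
# Lei–Zhang 2011, §2: the Moser chain on parabolic cylinders (from (2.5) to the mean value bound)

Analysis/FluidPDE proofs file (theorems only), on the discharge path of the named fact
`Literature.Analysis.FluidPDE.LeiZhang2011_liouville` (Z. Lei, Q. S. Zhang, J. Funct. Anal. 261
(2011) = arXiv:1011.5066, §2, (2.5)–(2.6) p. 8: "For integers `j ≥ 0` and a constant
`σ = 1/3`, set `σ₂ = ½(1 + σ^{j+1})`, `σ₁ = ½(1 + σ^j)`, `q = (10/9)^j` in (2.5). … By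
iteration … We take the limit `j → ∞` to yield that `sup_{P(R/2)} |Γ| ≲ …`").

Here the bookkeeping of that iteration, free of the equation: if a nonnegative space–time
function `u` satisfies, on the cylinders `Q_k = (−r_k², 0] × B̄(0, r_k)`,
`r_k = (ρ/2)(1 + 3^{-k})` (so `Q_0 = Q(ρ)`, `⋂ Q_k ⊇ Q(ρ/2)`), the reverse Hölder inequalities

`∬_{(−r_{k+1}², 0)×B(0,r_{k+1})} u^{p_{k+1}} ≤ (C₀ b^k)^{10/9} (∬_{Q_k} u^{p_k})^{10/9}`,
`p_k = 4 (10/9)^k`,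

then `‖u‖_{L^∞(Q(ρ/2))} ≤ C₀^{5/2} b^{45/2} ‖u‖_{L⁴(Q(ρ))}`
(`LeiZhang2011.eLpNorm_top_cylinder_le_of_reverse_holder`, from the tree's abstract
`eLpNorm_top_le_of_moser_chain` with `p₀ = 4`, `χ = 10/9`).

## References

* Z. Lei, Q. S. Zhang, J. Funct. Anal. 261 (2011) = arXiv:1011.5066, §2, (2.5)–(2.6), p. 8.
  [LeiZhang2011]
-/

noncomputable section

open MeasureTheory Set Function Filter Metric
open _root_.Topology
open scoped NNReal ENNReal

namespace Literature.Analysis.FluidPDE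

namespace LeiZhang2011

open Literature.Analysis.FunctionSpaces

/-- The radii of the Moser chain decrease from `ρ` to `ρ/2`: `ρ/2 ≤ r_k ≤ ρ`, `r_k > 0`.
[folklore] -/
theorem moser_radius_bounds {ρ : ℝ} (hρ : 0 < ρ) (k : ℕ) :
    0 < ρ / 2 * (1 + (1 / 3 : ℝ) ^ k) ∧ ρ / 2 ≤ ρ / 2 * (1 + (1 / 3 : ℝ) ^ k) ∧
      ρ / 2 * (1 + (1 / 3 : ℝ) ^ k) ≤ ρ := by
  have h1 : 0 ≤ (1 / 3 : ℝ) ^ k := by positivity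
  have h2 : (1 / 3 : ℝ) ^ k ≤ 1 := pow_le_one₀ (by norm_num) (by norm_num)
  refine ⟨by positivity, ?_, ?_⟩ <;> nlinarith

/-- **The Moser chain on parabolic cylinders** (Lei–Zhang 2011, (2.5)–(2.6)): reverse Hölder
inequalities between the consecutive cylinders `Q_k = (−r_k², 0] × B̄(0, r_k)`,
`r_k = (ρ/2)(1 + 3^{-k})`, with exponents `p_k = 4(10/9)^k` and constants `(C₀ b^k)^{10/9}`,
imply the mean value bound `‖u‖_{L^∞(Q(ρ/2))} ≤ C₀^{5/2} b^{45/2} ‖u‖_{L⁴(Q(ρ))}`. [cite: LeiZhang2011, §2 (2.5)–(2.6) (arXiv p. 8), the iteration] -/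
theorem eLpNorm_top_cylinder_le_of_reverse_holder {u : ℝ × EuclideanSpace ℝ (Fin 3) → ℝ}
    (hu : AEStronglyMeasurable u ((volume : Measure ℝ).prod (volume : Measure (EuclideanSpace ℝ (Fin 3)))))
    (hu0 : ∀ p, 0 ≤ u p) {ρ : ℝ} (hρ : 0 < ρ) {C₀ b : ℝ≥0} (hC₀ : C₀ ≠ 0) (hb : b ≠ 0)
    (H : ∀ k : ℕ,
      ∫⁻ p in Ioo (-(ρ / 2 * (1 + (1 / 3 : ℝ) ^ (k + 1))) ^ 2) 0 ×ˢ
          ball (0 : EuclideanSpace ℝ (Fin 3)) (ρ / 2 * (1 + (1 / 3 : ℝ) ^ (k + 1))),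
          ENNReal.ofReal (u p) ^ (4 * (10 / 9 : ℝ) ^ (k + 1)) ∂((volume : Measure ℝ).prod volume) ≤
        (((C₀ : ℝ≥0∞) * (b : ℝ≥0∞) ^ k) ^ (10 / 9 : ℝ)) *
          (∫⁻ p in Ioc (-(ρ / 2 * (1 + (1 / 3 : ℝ) ^ k)) ^ 2) 0 ×ˢ
              closedBall (0 : EuclideanSpace ℝ (Fin 3)) (ρ / 2 * (1 + (1 / 3 : ℝ) ^ k)),
              ENNReal.ofReal (u p) ^ (4 * (10 / 9 : ℝ) ^ k) ∂((volume : Measure ℝ).prod volume)) ^ (10 / 9 : ℝ)) :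
    eLpNorm u ∞ (((volume : Measure ℝ).prod (volume : Measure (EuclideanSpace ℝ (Fin 3)))).restrict
        (Ioc (-(ρ / 2) ^ 2) 0 ×ˢ closedBall (0 : EuclideanSpace ℝ (Fin 3)) (ρ / 2))) ≤
      (C₀ : ℝ≥0∞) ^ (5 / 2 : ℝ) * (b : ℝ≥0∞) ^ (45 / 2 : ℝ) *
        eLpNorm u (ENNReal.ofReal 4) (((volume : Measure ℝ).prod
          (volume : Measure (EuclideanSpace ℝ (Fin 3)))).restrict
            (Ioc (-ρ ^ 2) 0 ×ˢ closedBall (0 : EuclideanSpace ℝ (Fin 3)) ρ)) := by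
  set μ : Measure (ℝ × EuclideanSpace ℝ (Fin 3)) := (volume : Measure ℝ).prod volume with hμ
  -- the radii and the cylinders
  obtain ⟨r, hr⟩ : ∃ r : ℕ → ℝ, ∀ k, r k = ρ / 2 * (1 + (1 / 3 : ℝ) ^ k) := ⟨_, fun _ => rfl⟩
  have hrb : ∀ k, 0 < r k ∧ ρ / 2 ≤ r k ∧ r k ≤ ρ := fun k => by rw [hr k]; exact moser_radius_bounds hρ k
  set A : ℕ → Set (ℝ × EuclideanSpace ℝ (Fin 3)) := fun k =>
    Ioc (-(r k) ^ 2) 0 ×ˢ closedBall (0 : EuclideanSpace ℝ (Fin 3)) (r k) with hA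
  -- the exponents
  have hp : ∀ k : ℕ, (0 : ℝ) < 4 * (10 / 9 : ℝ) ^ k := fun k => by positivity
  -- the interior cylinder of level `k+1` is a.e. equal to `A (k+1)`
  have hae : ∀ k, (Ioo (-(r (k + 1)) ^ 2) 0 ×ˢ ball (0 : EuclideanSpace ℝ (Fin 3)) (r (k + 1)) :
      Set (ℝ × EuclideanSpace ℝ (Fin 3))) =ᵐ[μ] A (k + 1) := fun k =>
    Measure.set_prod_ae_eq (Ioo_ae_eq_Ioc (μ := (volume : Measure ℝ)))
      (JohnNirenberg.closedBall_ae_eq_ball (0 : EuclideanSpace ℝ (Fin 3)) (hrb (k + 1)).1).symm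
  -- eLpNorm in terms of the lintegral
  have hnorm : ∀ (k : ℕ) (S : Set (ℝ × EuclideanSpace ℝ (Fin 3))),
      eLpNorm u (ENNReal.ofReal (4 * (10 / 9 : ℝ) ^ k)) (μ.restrict S) =
        (∫⁻ p in S, ENNReal.ofReal (u p) ^ (4 * (10 / 9 : ℝ) ^ k) ∂μ) ^ (1 / (4 * (10 / 9 : ℝ) ^ k)) := by
    intro k S
    rw [eLpNorm_eq_lintegral_rpow_enorm_toReal (ENNReal.ofReal_pos.2 (hp k)).ne' ENNReal.ofReal_ne_top,
      ENNReal.toReal_ofReal (hp k).le]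
    congr 1
    refine lintegral_congr fun p => ?_
    rw [Real.enorm_eq_ofReal (hu0 p)]
  -- the chain hypothesis in `eLpNorm` form
  have Hchain : ∀ k : ℕ, eLpNorm u (ENNReal.ofReal (4 * (10 / 9 : ℝ) ^ (k + 1))) (μ.restrict (A (k + 1))) ≤
      ((C₀ : ℝ≥0∞) * (b : ℝ≥0∞) ^ k) ^ (1 / (4 * (10 / 9 : ℝ) ^ k)) *
        eLpNorm u (ENNReal.ofReal (4 * (10 / 9 : ℝ) ^ k)) (μ.restrict (A k)) := by
    intro k
    have h := H k
    simp only [← hr] at h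
    rw [hnorm, hnorm, ← Measure.restrict_congr_set (hae k)]
    have hpk1 : 0 < 1 / (4 * (10 / 9 : ℝ) ^ (k + 1)) := by positivity
    calc (∫⁻ p in Ioo (-(r (k + 1)) ^ 2) 0 ×ˢ ball (0 : EuclideanSpace ℝ (Fin 3)) (r (k + 1)),
          ENNReal.ofReal (u p) ^ (4 * (10 / 9 : ℝ) ^ (k + 1)) ∂μ) ^ (1 / (4 * (10 / 9 : ℝ) ^ (k + 1)))
        ≤ ((((C₀ : ℝ≥0∞) * (b : ℝ≥0∞) ^ k) ^ (10 / 9 : ℝ)) *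
            (∫⁻ p in A k, ENNReal.ofReal (u p) ^ (4 * (10 / 9 : ℝ) ^ k) ∂μ) ^ (10 / 9 : ℝ)) ^
              (1 / (4 * (10 / 9 : ℝ) ^ (k + 1))) := ENNReal.rpow_le_rpow h hpk1.le
      _ = ((C₀ : ℝ≥0∞) * (b : ℝ≥0∞) ^ k) ^ (1 / (4 * (10 / 9 : ℝ) ^ k)) *
            (∫⁻ p in A k, ENNReal.ofReal (u p) ^ (4 * (10 / 9 : ℝ) ^ k) ∂μ) ^ (1 / (4 * (10 / 9 : ℝ) ^ k)) := by
          rw [ENNReal.mul_rpow_of_nonneg _ _ hpk1.le, ← ENNReal.rpow_mul, ← ENNReal.rpow_mul]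
          congr 2 <;> · rw [pow_succ]; field_simp
  -- the abstract Moser chain
  have hchain := eLpNorm_top_le_of_moser_chain (μ := μ) hu (A := A) (p₀ := 4) (χ := 10 / 9)
    (by norm_num) (by norm_num) hC₀ hb Hchain
  -- `⋂ A k ⊇ Q(ρ/2)`, `A 0 = Q(ρ)`
  have hA0 : A 0 = Ioc (-ρ ^ 2) 0 ×ˢ closedBall (0 : EuclideanSpace ℝ (Fin 3)) ρ := by
    simp only [hA, hr, pow_zero]; norm_num
  have hsub : Ioc (-(ρ / 2) ^ 2) 0 ×ˢ closedBall (0 : EuclideanSpace ℝ (Fin 3)) (ρ / 2) ⊆ ⋂ k, A k := by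
    refine subset_iInter fun k => prod_mono (Ioc_subset_Ioc ?_ le_rfl) (closedBall_subset_closedBall (hrb k).2.1)
    have := (hrb k).2.1
    nlinarith [hρ]
  calc eLpNorm u ∞ (μ.restrict (Ioc (-(ρ / 2) ^ 2) 0 ×ˢ closedBall (0 : EuclideanSpace ℝ (Fin 3)) (ρ / 2)))
      ≤ eLpNorm u ∞ (μ.restrict (⋂ k, A k)) := eLpNorm_mono_measure u (Measure.restrict_mono hsub le_rfl)
    _ ≤ (C₀ : ℝ≥0∞) ^ ((10 / 9 : ℝ) / (4 * (10 / 9 - 1))) * (b : ℝ≥0∞) ^ ((10 / 9 : ℝ) / (4 * (10 / 9 - 1) ^ 2)) *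
          eLpNorm u (ENNReal.ofReal 4) (μ.restrict (A 0)) := hchain
    _ = (C₀ : ℝ≥0∞) ^ (5 / 2 : ℝ) * (b : ℝ≥0∞) ^ (45 / 2 : ℝ) *
          eLpNorm u (ENNReal.ofReal 4) (μ.restrict (Ioc (-ρ ^ 2) 0 ×ˢ closedBall (0 : EuclideanSpace ℝ (Fin 3)) ρ)) := by
        rw [hA0]; norm_num

end LeiZhang2011

end Literature.Analysis.FluidPDE
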